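import Summits.CriticalPhenomena.PercolationContinuityZ3.Theorems.PercNearOneGluingNoHeavyLowerTailAntitheticFrozenPieces
import HarnessLib

/-!
# `NoHeavyLowerTail` (stmt-CriticalPhenomena-4575) — antithetic cluster pairs: the TWO-STAGE HARRIS THEOREM, abstract inner step
# (Step 1 of THEOREM 2H / THEOREM FAT, HOME/THEOREM-FAT.md §1, prim-hp-2 gen 59)

Support file (`--supports stmt-CriticalPhenomena-4575`, hull-port prover `prim-hp-2`, gen 59).  No definitions, no named facts, no sorries;
standard axioms.  Pure finite sums; the side-2 colourings are an abstract Boolean cube `Set ι`.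

SETTING.  Side 1: a finite family of pairs `(P₁ j, Q₁ j)`.  Side 2: a cube `T : Set ι ↦ (X₂ T, Y₂ T)` with `X₂` monotone, `Y₂` antitone and
the complement symmetry `Y₂ T = X₂ Tᶜ` (red/blue clusters of one graph), a vertex `z` of side 2, the bonus vertex `x` (joined to `y` on side 1
and `z` on side 2).  For odd twisted-monotone `h`, the two side-2 averages of THEOREM-FAT §1 are (unnormalised)
  `Gb h P Q := Σ_T h (P ∪ X₂ T) (Q ∪ Y₂ T ∪ {x}·[z ∈ Y₂ T])`        (all `T`; rows with `y ∉ P₁ j`; mass `cB = |Set ι|`),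
  `Gt h P Q := Σ_{T : z ∉ Y₂ T} h (P ∪ X₂ T ∪ {x}) (Q ∪ Y₂ T)`     (rows with `y ∈ P₁ j`; mass `cR = #{T : z ∉ Y₂ T}`).
* `Antithetic.TwoStage.inner_bound`: if side 2 is R-ASSOCIATED (hypothesis `hR`: Harris holds on `{T : z ∉ Y₂ T}` for twisted-monotone functions
  of the pair) then  `CHANGE := Σ_j Σ_{T : ¬(y ∈ P₁ j ∧ z ∈ Y₂ T)} h₁h₂(P₁ j ∪ X₂ T ∪ {x}·[y ∈ P₁ j], Q₁ j ∪ Y₂ T ∪ {x}·[z ∈ Y₂ T])`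
  `≥ (1/cB) Σ_{j : y ∉ P₁ j} Gb h₁ Gb h₂ + (1/cR) Σ_{j : y ∈ P₁ j} Gt h₁ Gt h₂`  (Harris row by row).
* `Antithetic.TwoStage.constraint_chain`: the chain (𝒞) of THEOREM-FAT §1 in unnormalised form:
  `−cB·Gt h Q P ≤ cR·Gb h P Q`,  `Gb h P Q + Gb h Q P ≤ 0`,  `−cR·Gb h Q P ≤ cB·Gt h P Q`
  (Harris for the down-set `{z ∉ X₂}` / the up-set `{z ∉ Y₂}`, and the antipodal pairing `T ↔ Tᶜ`).
* `Antithetic.TwoStage.Gb_mono`, `Gt_mono`: both averages are twisted-monotone.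
With `Antithetic.TwoStage.side_sum_nonneg` (…AntitheticTwoStageSide; `gb = Gb/cB`, `gt = Gt/cR`, `cR ≤ cB`) this gives CHANGE ≥ 0, and
`Antithetic.DegTwo.deg2_vertex_of_change` turns CHANGE ≥ 0 into the vertex antithetic inequality at `x` (THEOREM 2H).
[cite: VandenbergHaggstromKahn2005, §1 p. 6 ("Harris' inequality")]
-/

noncomputable section

namespace Summit.CriticalPhenomena.PercolationContinuityZ3.Theorems

open scoped Classical

namespace Antithetic

namespace TwoStage

variable {V : Type*} {ι : Type*} [Fintype ι]

/-- Harris for an UP-set: for monotone `F` and an up-closed predicate `U` on `Set ι`,  `#U · Σ F ≤ |Set ι| · Σ_U F`. [folklore] -/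
theorem card_mul_sum_le_of_upset (F : Set ι → ℝ) (hF : Monotone F) (U : Set ι → Prop) [DecidablePred U]
    (hU : ∀ ⦃S S' : Set ι⦄, S ⊆ S' → U S → U S') :
    ((Finset.univ.filter fun S => U S).card : ℝ) * ∑ S, F S ≤ (Fintype.card (Set ι) : ℝ) * ∑ S ∈ Finset.univ.filter (fun S => U S), F S := by
  have hb : Monotone (fun S : Set ι => if U S then (1 : ℝ) else 0) := by
    intro S S' hSS'
    by_cases h : U S
    · simp [h, hU hSS' h]
    · by_cases h' : U S' <;> simp [h, h']
  have h := harris_uniform_cov hF hb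
  have e1 : ∑ S : Set ι, (if U S then (1 : ℝ) else 0) = ((Finset.univ.filter fun S => U S).card : ℝ) := by
    rw [Finset.sum_ite, Finset.sum_const_zero, add_zero, Finset.sum_const, nsmul_eq_mul, mul_one]
  have e2 : ∑ S : Set ι, F S * (if U S then (1 : ℝ) else 0) = ∑ S ∈ Finset.univ.filter (fun S => U S), F S := by
    rw [← Finset.sum_filter_add_sum_filter_not Finset.univ (fun S => U S)]
    have h0 : ∑ S ∈ Finset.univ.filter (fun S => ¬ U S), F S * (if U S then (1 : ℝ) else 0) = 0 :=
      Finset.sum_eq_zero fun S hS => by simp [(Finset.mem_filter.1 hS).2]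
    rw [h0, add_zero]
    exact Finset.sum_congr rfl fun S hS => by simp [(Finset.mem_filter.1 hS).2]
  rw [e1, e2] at h
  linarith

/-- Harris for a DOWN-set: for monotone `F` and a down-closed predicate `D` on `Set ι`,  `|Set ι| · Σ_D F ≤ #D · Σ F`. [folklore] -/
theorem sum_le_card_mul_of_downset (F : Set ι → ℝ) (hF : Monotone F) (D : Set ι → Prop) [DecidablePred D]
    (hD : ∀ ⦃S S' : Set ι⦄, S ⊆ S' → D S' → D S) :
    (Fintype.card (Set ι) : ℝ) * ∑ S ∈ Finset.univ.filter (fun S => D S), F S ≤ ((Finset.univ.filter fun S => D S).card : ℝ) * ∑ S, F S := by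
  have hb : Monotone (fun S : Set ι => if D S then (-1 : ℝ) else 0) := by
    intro S S' hSS'
    by_cases h' : D S'
    · simp [h', hD hSS' h']
    · by_cases h : D S <;> simp [h, h']
  have h := harris_uniform_cov hF hb
  have e1 : ∑ S : Set ι, (if D S then (-1 : ℝ) else 0) = -((Finset.univ.filter fun S => D S).card : ℝ) := by
    rw [Finset.sum_ite, Finset.sum_const_zero, add_zero, Finset.sum_const, nsmul_eq_mul, mul_neg, mul_one]
  have e2 : ∑ S : Set ι, F S * (if D S then (-1 : ℝ) else 0) = -∑ S ∈ Finset.univ.filter (fun S => D S), F S := by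
    rw [← Finset.sum_filter_add_sum_filter_not Finset.univ (fun S => D S)]
    have h0 : ∑ S ∈ Finset.univ.filter (fun S => ¬ D S), F S * (if D S then (-1 : ℝ) else 0) = 0 :=
      Finset.sum_eq_zero fun S hS => by simp [(Finset.mem_filter.1 hS).2]
    rw [h0, add_zero, ← Finset.sum_neg_distrib]
    exact Finset.sum_congr rfl fun S hS => by simp [(Finset.mem_filter.1 hS).2]
  rw [e1, e2] at h
  linarith

section Inner

variable (X₂ Y₂ : Set ι → Set V) (hX : Monotone X₂) (hY : Antitone Y₂) (hXY : ∀ T, Y₂ T = X₂ Tᶜ) (x z : V)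
include hX hY

omit hX hY in
/-- `Gb h` is twisted-monotone. [this work] -/
theorem Gb_mono {h : Set V → Set V → ℝ} (hh : ∀ ⦃A A' B B' : Set V⦄, A ⊆ A' → B' ⊆ B → h A B ≤ h A' B')
    ⦃A A' B B' : Set V⦄ (hA : A ⊆ A') (hB : B' ⊆ B) :
    (∑ T : Set ι, h (A ∪ X₂ T) (B ∪ Y₂ T ∪ {v | v ∈ ({x} : Set V) ∧ z ∈ Y₂ T})) ≤
      ∑ T : Set ι, h (A' ∪ X₂ T) (B' ∪ Y₂ T ∪ {v | v ∈ ({x} : Set V) ∧ z ∈ Y₂ T}) :=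
  Finset.sum_le_sum fun _ _ => hh (Set.union_subset_union_left _ hA)
    (Set.union_subset_union_left _ (Set.union_subset_union_left _ hB))

omit hX hY in
/-- `Gt h` is twisted-monotone. [this work] -/
theorem Gt_mono {h : Set V → Set V → ℝ} (hh : ∀ ⦃A A' B B' : Set V⦄, A ⊆ A' → B' ⊆ B → h A B ≤ h A' B')
    ⦃A A' B B' : Set V⦄ (hA : A ⊆ A') (hB : B' ⊆ B) :
    (∑ T ∈ Finset.univ.filter (fun T : Set ι => z ∉ Y₂ T), h (A ∪ X₂ T ∪ {x}) (B ∪ Y₂ T)) ≤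
      ∑ T ∈ Finset.univ.filter (fun T : Set ι => z ∉ Y₂ T), h (A' ∪ X₂ T ∪ {x}) (B' ∪ Y₂ T) :=
  Finset.sum_le_sum fun _ _ => hh (Set.union_subset_union_left _ (Set.union_subset_union_left _ hA))
    (Set.union_subset_union_left _ hB)

include hXY

/-- **The constraint chain (𝒞)** (HOME/THEOREM-FAT.md §1), unnormalised: with `cB = |Set ι|`, `cR = #{T : z ∉ Y₂ T}`,
`−cB·Gt h Q P ≤ cR·Gb h P Q`, `Gb h P Q + Gb h Q P ≤ 0`, `−cR·Gb h Q P ≤ cB·Gt h P Q`. [this work] -/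
theorem constraint_chain {h : Set V → Set V → ℝ} (hh : ∀ ⦃A A' B B' : Set V⦄, A ⊆ A' → B' ⊆ B → h A B ≤ h A' B')
    (hodd : ∀ A B, h B A = -h A B) (P Q : Set V) :
    -((Fintype.card (Set ι) : ℝ) * ∑ T ∈ Finset.univ.filter (fun T : Set ι => z ∉ Y₂ T), h (Q ∪ X₂ T ∪ {x}) (P ∪ Y₂ T)) ≤
        ((Finset.univ.filter fun T : Set ι => z ∉ Y₂ T).card : ℝ) *
          ∑ T : Set ι, h (P ∪ X₂ T) (Q ∪ Y₂ T ∪ {v | v ∈ ({x} : Set V) ∧ z ∈ Y₂ T}) ∧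
      (∑ T : Set ι, h (P ∪ X₂ T) (Q ∪ Y₂ T ∪ {v | v ∈ ({x} : Set V) ∧ z ∈ Y₂ T})) +
          ∑ T : Set ι, h (Q ∪ X₂ T) (P ∪ Y₂ T ∪ {v | v ∈ ({x} : Set V) ∧ z ∈ Y₂ T}) ≤ 0 ∧
      -(((Finset.univ.filter fun T : Set ι => z ∉ Y₂ T).card : ℝ) *
          ∑ T : Set ι, h (Q ∪ X₂ T) (P ∪ Y₂ T ∪ {v | v ∈ ({x} : Set V) ∧ z ∈ Y₂ T})) ≤
        (Fintype.card (Set ι) : ℝ) * ∑ T ∈ Finset.univ.filter (fun T : Set ι => z ∉ Y₂ T), h (P ∪ X₂ T ∪ {x}) (Q ∪ Y₂ T) := by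
  have hXc : ∀ T, X₂ Tᶜ = Y₂ T := fun T => (hXY T).symm
  have hYc : ∀ T, Y₂ Tᶜ = X₂ T := fun T => by rw [hXY, compl_compl]
  -- the integrand `F T = h (P ∪ X₂ T) (Q ∪ Y₂ T ∪ x[z ∈ Y₂ T])` of `Gb` is monotone in `T`
  have hFmono : Monotone (fun T : Set ι => h (P ∪ X₂ T) (Q ∪ Y₂ T ∪ {v | v ∈ ({x} : Set V) ∧ z ∈ Y₂ T})) := by
    intro T T' hTT'
    exact hh (Set.union_subset_union_right _ (hX hTT'))
      (Set.union_subset_union (Set.union_subset_union_right _ (hY hTT')) (fun v hv => ⟨hv.1, hY hTT' hv.2⟩))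
  -- the integrand `G T = h (P ∪ X₂ T ∪ x[z ∈ X₂ T]) (Q ∪ Y₂ T)` is monotone in `T`
  have hGmono : Monotone (fun T : Set ι => h (P ∪ X₂ T ∪ {v | v ∈ ({x} : Set V) ∧ z ∈ X₂ T}) (Q ∪ Y₂ T)) := by
    intro T T' hTT'
    exact hh (Set.union_subset_union (Set.union_subset_union_right _ (hX hTT')) (fun v hv => ⟨hv.1, hX hTT' hv.2⟩))
      (Set.union_subset_union_right _ (hY hTT'))
  have hsumc : ∀ (c : Set ι → ℝ), ∑ T : Set ι, c Tᶜ = ∑ T : Set ι, c T := fun c =>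
    Fintype.sum_equiv (Equiv.mk compl compl compl_compl compl_compl) _ _ fun T => rfl
  refine ⟨?_, ?_, ?_⟩
  · -- (i): −Gt h Q P = Σ_{z ∉ X₂ S} h (P ∪ X₂ S, Q ∪ Y₂ S ∪ {x}) ≤ Σ_{z ∉ X₂ S} F S, then Harris for the down-set {z ∉ X₂}
    have e1 : -(∑ T ∈ Finset.univ.filter (fun T : Set ι => z ∉ Y₂ T), h (Q ∪ X₂ T ∪ {x}) (P ∪ Y₂ T)) =
        ∑ S ∈ Finset.univ.filter (fun S : Set ι => z ∉ X₂ S), h (P ∪ X₂ S) (Q ∪ Y₂ S ∪ {x}) := by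
      rw [← Finset.sum_neg_distrib]
      refine Finset.sum_nbij' compl compl ?_ ?_ (fun T _ => compl_compl T) (fun T _ => compl_compl T) ?_
      · intro T hT
        simp only [Finset.mem_filter, Finset.mem_univ, true_and] at hT ⊢; rwa [hXc]
      · intro S hS
        simp only [Finset.mem_filter, Finset.mem_univ, true_and] at hS ⊢; rwa [hYc]
      · intro T _
        rw [hodd, neg_neg, hXc, hYc]
    have e2 : ∑ S ∈ Finset.univ.filter (fun S : Set ι => z ∉ X₂ S), h (P ∪ X₂ S) (Q ∪ Y₂ S ∪ {x}) ≤
        ∑ S ∈ Finset.univ.filter (fun S : Set ι => z ∉ X₂ S), h (P ∪ X₂ S) (Q ∪ Y₂ S ∪ {v | v ∈ ({x} : Set V) ∧ z ∈ Y₂ S}) :=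
      Finset.sum_le_sum fun S _ => hh subset_rfl (Set.union_subset_union_right _ (fun v hv => hv.1))
    have e3 := sum_le_card_mul_of_downset _ hFmono (fun S => z ∉ X₂ S) (fun S S' hSS' h' hz => h' (hX hSS' hz))
    have ecard : ((Finset.univ.filter fun S : Set ι => z ∉ X₂ S).card : ℝ) = ((Finset.univ.filter fun T : Set ι => z ∉ Y₂ T).card : ℝ) := by
      have hc : (Finset.univ.filter fun S : Set ι => z ∉ X₂ S).card = (Finset.univ.filter fun T : Set ι => z ∉ Y₂ T).card := by
        refine Finset.card_nbij' compl compl ?_ ?_ (fun T _ => compl_compl T) (fun T _ => compl_compl T)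
        · intro S hS
          simp only [Finset.coe_filter, Finset.mem_univ, true_and, Set.mem_setOf_eq] at hS ⊢
          rwa [hYc]
        · intro T hT
          simp only [Finset.coe_filter, Finset.mem_univ, true_and, Set.mem_setOf_eq] at hT ⊢
          rwa [hXc]
      rw [hc]
    have hN : (0 : ℝ) ≤ (Fintype.card (Set ι) : ℝ) := by positivity
    have e5 := mul_le_mul_of_nonneg_left e2 hN
    rw [ecard] at e3
    rw [neg_mul_eq_mul_neg, e1]
    exact le_trans e5 e3
  · -- (ii): pair T with Tᶜ
    have e1 : ∑ T : Set ι, h (Q ∪ X₂ T) (P ∪ Y₂ T ∪ {v | v ∈ ({x} : Set V) ∧ z ∈ Y₂ T}) =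
        -∑ T : Set ι, h (P ∪ X₂ T ∪ {v | v ∈ ({x} : Set V) ∧ z ∈ X₂ T}) (Q ∪ Y₂ T) := by
      rw [← Finset.sum_neg_distrib, ← hsumc (fun T => -h (P ∪ X₂ T ∪ {v | v ∈ ({x} : Set V) ∧ z ∈ X₂ T}) (Q ∪ Y₂ T))]
      refine Finset.sum_congr rfl fun T _ => ?_
      rw [hodd (P ∪ Y₂ T ∪ {v | v ∈ ({x} : Set V) ∧ z ∈ Y₂ T}) (Q ∪ X₂ T), hXc, hYc]
    have e2 : ∑ T : Set ι, h (P ∪ X₂ T) (Q ∪ Y₂ T ∪ {v | v ∈ ({x} : Set V) ∧ z ∈ Y₂ T}) ≤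
        ∑ T : Set ι, h (P ∪ X₂ T ∪ {v | v ∈ ({x} : Set V) ∧ z ∈ X₂ T}) (Q ∪ Y₂ T) :=
      Finset.sum_le_sum fun T _ => hh Set.subset_union_left Set.subset_union_left
    rw [e1]; linarith
  · -- (iii): −Gb h Q P = Σ_T G T; Harris for the up-set {z ∉ Y₂}; then G ≤ the integrand of Gt
    have e1 : ∑ T : Set ι, h (Q ∪ X₂ T) (P ∪ Y₂ T ∪ {v | v ∈ ({x} : Set V) ∧ z ∈ Y₂ T}) =
        -∑ T : Set ι, h (P ∪ X₂ T ∪ {v | v ∈ ({x} : Set V) ∧ z ∈ X₂ T}) (Q ∪ Y₂ T) := by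
      rw [← Finset.sum_neg_distrib, ← hsumc (fun T => -h (P ∪ X₂ T ∪ {v | v ∈ ({x} : Set V) ∧ z ∈ X₂ T}) (Q ∪ Y₂ T))]
      refine Finset.sum_congr rfl fun T _ => ?_
      rw [hodd (P ∪ Y₂ T ∪ {v | v ∈ ({x} : Set V) ∧ z ∈ Y₂ T}) (Q ∪ X₂ T), hXc, hYc]
    have e3 := card_mul_sum_le_of_upset _ hGmono (fun T => z ∉ Y₂ T) (fun T T' hTT' hz hz' => hz (hY hTT' hz'))
    have e4 : ∑ T ∈ Finset.univ.filter (fun T : Set ι => z ∉ Y₂ T), h (P ∪ X₂ T ∪ {v | v ∈ ({x} : Set V) ∧ z ∈ X₂ T}) (Q ∪ Y₂ T) ≤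
        ∑ T ∈ Finset.univ.filter (fun T : Set ι => z ∉ Y₂ T), h (P ∪ X₂ T ∪ {x}) (Q ∪ Y₂ T) :=
      Finset.sum_le_sum fun T _ => hh (Set.union_subset_union_right _ (fun v hv => hv.1)) subset_rfl
    have hN : (0 : ℝ) ≤ (Fintype.card (Set ι) : ℝ) := by positivity
    have e5 := mul_le_mul_of_nonneg_left e4 hN
    rw [e1, mul_neg, neg_neg]
    exact le_trans e3 e5

omit hXY in
/-- **Inner Harris, row by row** (HOME/THEOREM-FAT.md §1 (1)): with side 2 R-associated (hypothesis `hR`),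
`CHANGE ≥ (1/cB)·Σ_{y ∉ P₁ j} Gb h₁ · Gb h₂ + (1/cR)·Σ_{y ∈ P₁ j} Gt h₁ · Gt h₂`. [this work] -/
theorem inner_bound {J : Type*} [Fintype J] (P₁ Q₁ : J → Set V) (y : V)
    (hR : ∀ Φ₁ Φ₂ : Set V → Set V → ℝ,
      (∀ ⦃A A' B B' : Set V⦄, A ⊆ A' → B' ⊆ B → Φ₁ A B ≤ Φ₁ A' B') → (∀ ⦃A A' B B' : Set V⦄, A ⊆ A' → B' ⊆ B → Φ₂ A B ≤ Φ₂ A' B') →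
      (∑ T ∈ Finset.univ.filter (fun T : Set ι => z ∉ Y₂ T), Φ₁ (X₂ T) (Y₂ T)) *
          (∑ T ∈ Finset.univ.filter (fun T : Set ι => z ∉ Y₂ T), Φ₂ (X₂ T) (Y₂ T)) ≤
        ((Finset.univ.filter fun T : Set ι => z ∉ Y₂ T).card : ℝ) *
          ∑ T ∈ Finset.univ.filter (fun T : Set ι => z ∉ Y₂ T), Φ₁ (X₂ T) (Y₂ T) * Φ₂ (X₂ T) (Y₂ T))
    (hcR : 0 < (Finset.univ.filter fun T : Set ι => z ∉ Y₂ T).card)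
    {h₁ h₂ : Set V → Set V → ℝ}
    (hh₁ : ∀ ⦃A A' B B' : Set V⦄, A ⊆ A' → B' ⊆ B → h₁ A B ≤ h₁ A' B') (hh₂ : ∀ ⦃A A' B B' : Set V⦄, A ⊆ A' → B' ⊆ B → h₂ A B ≤ h₂ A' B') :
    (∑ j ∈ Finset.univ.filter (fun j => y ∉ P₁ j),
        (∑ T : Set ι, h₁ (P₁ j ∪ X₂ T) (Q₁ j ∪ Y₂ T ∪ {v | v ∈ ({x} : Set V) ∧ z ∈ Y₂ T})) *
          (∑ T : Set ι, h₂ (P₁ j ∪ X₂ T) (Q₁ j ∪ Y₂ T ∪ {v | v ∈ ({x} : Set V) ∧ z ∈ Y₂ T}))) / (Fintype.card (Set ι) : ℝ) +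
      (∑ j ∈ Finset.univ.filter (fun j => y ∈ P₁ j),
        (∑ T ∈ Finset.univ.filter (fun T : Set ι => z ∉ Y₂ T), h₁ (P₁ j ∪ X₂ T ∪ {x}) (Q₁ j ∪ Y₂ T)) *
          (∑ T ∈ Finset.univ.filter (fun T : Set ι => z ∉ Y₂ T), h₂ (P₁ j ∪ X₂ T ∪ {x}) (Q₁ j ∪ Y₂ T))) /
        ((Finset.univ.filter fun T : Set ι => z ∉ Y₂ T).card : ℝ) ≤
    ∑ j, ∑ T ∈ Finset.univ.filter (fun T : Set ι => ¬ (y ∈ P₁ j ∧ z ∈ Y₂ T)),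
      h₁ (P₁ j ∪ X₂ T ∪ {v | v ∈ ({x} : Set V) ∧ y ∈ P₁ j}) (Q₁ j ∪ Y₂ T ∪ {v | v ∈ ({x} : Set V) ∧ z ∈ Y₂ T}) *
        h₂ (P₁ j ∪ X₂ T ∪ {v | v ∈ ({x} : Set V) ∧ y ∈ P₁ j}) (Q₁ j ∪ Y₂ T ∪ {v | v ∈ ({x} : Set V) ∧ z ∈ Y₂ T}) := by
  set cB : ℝ := (Fintype.card (Set ι) : ℝ) with hcBdef
  set U : Finset (Set ι) := Finset.univ.filter (fun T : Set ι => z ∉ Y₂ T) with hUdef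
  set cR : ℝ := (U.card : ℝ) with hcRdef
  have hcBpos : 0 < cB := by rw [hcBdef]; exact_mod_cast Fintype.card_pos
  have hcRpos : 0 < cR := by rw [hcRdef]; exact_mod_cast hcR
  -- the summand
  let Ψ : J → Set ι → ℝ := fun j T =>
    h₁ (P₁ j ∪ X₂ T ∪ {v | v ∈ ({x} : Set V) ∧ y ∈ P₁ j}) (Q₁ j ∪ Y₂ T ∪ {v | v ∈ ({x} : Set V) ∧ z ∈ Y₂ T}) *
      h₂ (P₁ j ∪ X₂ T ∪ {v | v ∈ ({x} : Set V) ∧ y ∈ P₁ j}) (Q₁ j ∪ Y₂ T ∪ {v | v ∈ ({x} : Set V) ∧ z ∈ Y₂ T})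
  show _ ≤ ∑ j, ∑ T ∈ Finset.univ.filter (fun T : Set ι => ¬ (y ∈ P₁ j ∧ z ∈ Y₂ T)), Ψ j T
  -- red rows (y ∈ P₁ j): the R-association hypothesis
  have hrow_red : ∀ j, y ∈ P₁ j →
      (∑ T ∈ U, h₁ (P₁ j ∪ X₂ T ∪ {x}) (Q₁ j ∪ Y₂ T)) * (∑ T ∈ U, h₂ (P₁ j ∪ X₂ T ∪ {x}) (Q₁ j ∪ Y₂ T)) / cR ≤
        ∑ T ∈ Finset.univ.filter (fun T : Set ι => ¬ (y ∈ P₁ j ∧ z ∈ Y₂ T)), Ψ j T := by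
    intro j hy
    have hset : Finset.univ.filter (fun T : Set ι => ¬ (y ∈ P₁ j ∧ z ∈ Y₂ T)) = U := by
      ext T; simp only [hUdef, Finset.mem_filter, Finset.mem_univ, true_and]; tauto
    have hsum : ∑ T ∈ Finset.univ.filter (fun T : Set ι => ¬ (y ∈ P₁ j ∧ z ∈ Y₂ T)), Ψ j T =
        ∑ T ∈ U, h₁ (P₁ j ∪ X₂ T ∪ {x}) (Q₁ j ∪ Y₂ T) * h₂ (P₁ j ∪ X₂ T ∪ {x}) (Q₁ j ∪ Y₂ T) := by
      rw [hset]
      refine Finset.sum_congr rfl fun T hT => ?_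
      have hz : z ∉ Y₂ T := by simpa [hUdef] using hT
      have h1 : {v | v ∈ ({x} : Set V) ∧ y ∈ P₁ j} = {x} := by ext v; simp [hy]
      have h2 : Q₁ j ∪ Y₂ T ∪ {v | v ∈ ({x} : Set V) ∧ z ∈ Y₂ T} = Q₁ j ∪ Y₂ T := by
        ext v; simp only [Set.mem_union, Set.mem_setOf_eq]; tauto
      show h₁ (P₁ j ∪ X₂ T ∪ {v | v ∈ ({x} : Set V) ∧ y ∈ P₁ j}) (Q₁ j ∪ Y₂ T ∪ {v | v ∈ ({x} : Set V) ∧ z ∈ Y₂ T}) *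
        h₂ (P₁ j ∪ X₂ T ∪ {v | v ∈ ({x} : Set V) ∧ y ∈ P₁ j}) (Q₁ j ∪ Y₂ T ∪ {v | v ∈ ({x} : Set V) ∧ z ∈ Y₂ T}) = _
      rw [h1, h2]
    have hH := hR (fun A B => h₁ (P₁ j ∪ A ∪ {x}) (Q₁ j ∪ B)) (fun A B => h₂ (P₁ j ∪ A ∪ {x}) (Q₁ j ∪ B))
      (fun A A' B B' hA hB => hh₁ (Set.union_subset_union_left _ (Set.union_subset_union_right _ hA)) (Set.union_subset_union_right _ hB))
      (fun A A' B B' hA hB => hh₂ (Set.union_subset_union_left _ (Set.union_subset_union_right _ hA)) (Set.union_subset_union_right _ hB))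
    rw [hsum, div_le_iff₀ hcRpos]
    beta_reduce at hH
    rw [hcRdef]
    linarith [hH]
  -- blue rows (y ∉ P₁ j): Harris on the whole cube
  have hrow_blue : ∀ j, y ∉ P₁ j →
      (∑ T : Set ι, h₁ (P₁ j ∪ X₂ T) (Q₁ j ∪ Y₂ T ∪ {v | v ∈ ({x} : Set V) ∧ z ∈ Y₂ T})) *
        (∑ T : Set ι, h₂ (P₁ j ∪ X₂ T) (Q₁ j ∪ Y₂ T ∪ {v | v ∈ ({x} : Set V) ∧ z ∈ Y₂ T})) / cB ≤
        ∑ T ∈ Finset.univ.filter (fun T : Set ι => ¬ (y ∈ P₁ j ∧ z ∈ Y₂ T)), Ψ j T := by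
    intro j hy
    have hset : Finset.univ.filter (fun T : Set ι => ¬ (y ∈ P₁ j ∧ z ∈ Y₂ T)) = Finset.univ := by
      ext T; simp only [Finset.mem_filter, Finset.mem_univ, true_and]; tauto
    have hsum : ∑ T ∈ Finset.univ.filter (fun T : Set ι => ¬ (y ∈ P₁ j ∧ z ∈ Y₂ T)), Ψ j T =
        ∑ T : Set ι, h₁ (P₁ j ∪ X₂ T) (Q₁ j ∪ Y₂ T ∪ {v | v ∈ ({x} : Set V) ∧ z ∈ Y₂ T}) *
          h₂ (P₁ j ∪ X₂ T) (Q₁ j ∪ Y₂ T ∪ {v | v ∈ ({x} : Set V) ∧ z ∈ Y₂ T}) := by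
      rw [hset]
      refine Finset.sum_congr rfl fun T _ => ?_
      have h1 : P₁ j ∪ X₂ T ∪ {v | v ∈ ({x} : Set V) ∧ y ∈ P₁ j} = P₁ j ∪ X₂ T := by
        ext v; simp only [Set.mem_union, Set.mem_setOf_eq]; tauto
      show h₁ (P₁ j ∪ X₂ T ∪ {v | v ∈ ({x} : Set V) ∧ y ∈ P₁ j}) (Q₁ j ∪ Y₂ T ∪ {v | v ∈ ({x} : Set V) ∧ z ∈ Y₂ T}) *
        h₂ (P₁ j ∪ X₂ T ∪ {v | v ∈ ({x} : Set V) ∧ y ∈ P₁ j}) (Q₁ j ∪ Y₂ T ∪ {v | v ∈ ({x} : Set V) ∧ z ∈ Y₂ T}) = _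
      rw [h1]
    have hmono : ∀ {h : Set V → Set V → ℝ}, (∀ ⦃A A' B B' : Set V⦄, A ⊆ A' → B' ⊆ B → h A B ≤ h A' B') →
        Monotone (fun T : Set ι => h (P₁ j ∪ X₂ T) (Q₁ j ∪ Y₂ T ∪ {v | v ∈ ({x} : Set V) ∧ z ∈ Y₂ T})) := by
      intro h hh T T' hTT'
      exact hh (Set.union_subset_union_right _ (hX hTT'))
        (Set.union_subset_union (Set.union_subset_union_right _ (hY hTT')) (fun v hv => ⟨hv.1, hY hTT' hv.2⟩))
    have hH := harris_uniform_cov (hmono hh₁) (hmono hh₂)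
    rw [hsum, div_le_iff₀ hcBpos]
    beta_reduce at hH
    rw [hcBdef]
    linarith [hH]
  -- assemble
  rw [← Finset.sum_filter_add_sum_filter_not Finset.univ (fun j => y ∉ P₁ j)]
  have hb : (∑ j ∈ Finset.univ.filter (fun j => y ∉ P₁ j),
        (∑ T : Set ι, h₁ (P₁ j ∪ X₂ T) (Q₁ j ∪ Y₂ T ∪ {v | v ∈ ({x} : Set V) ∧ z ∈ Y₂ T})) *
          (∑ T : Set ι, h₂ (P₁ j ∪ X₂ T) (Q₁ j ∪ Y₂ T ∪ {v | v ∈ ({x} : Set V) ∧ z ∈ Y₂ T}))) / cB ≤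
      ∑ j ∈ Finset.univ.filter (fun j => y ∉ P₁ j), ∑ T ∈ Finset.univ.filter (fun T : Set ι => ¬ (y ∈ P₁ j ∧ z ∈ Y₂ T)), Ψ j T := by
    rw [Finset.sum_div]
    exact Finset.sum_le_sum fun j hj => hrow_blue j (Finset.mem_filter.1 hj).2
  have hr : (∑ j ∈ Finset.univ.filter (fun j => y ∈ P₁ j),
        (∑ T ∈ U, h₁ (P₁ j ∪ X₂ T ∪ {x}) (Q₁ j ∪ Y₂ T)) * (∑ T ∈ U, h₂ (P₁ j ∪ X₂ T ∪ {x}) (Q₁ j ∪ Y₂ T))) / cR ≤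
      ∑ j ∈ Finset.univ.filter (fun j => ¬ (y ∉ P₁ j)), ∑ T ∈ Finset.univ.filter (fun T : Set ι => ¬ (y ∈ P₁ j ∧ z ∈ Y₂ T)), Ψ j T := by
    rw [Finset.sum_div]
    have hset : Finset.univ.filter (fun j => ¬ (y ∉ P₁ j)) = Finset.univ.filter (fun j => y ∈ P₁ j) := by
      ext j; simp only [Finset.mem_filter, Finset.mem_univ, true_and, not_not]
    rw [hset]
    exact Finset.sum_le_sum fun j hj => hrow_red j (Finset.mem_filter.1 hj).2
  linarith

end Inner

end TwoStage

end Antithetic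

end Summit.CriticalPhenomena.PercolationContinuityZ3.Theorems
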